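import Mathlib
import Summits.MatrixMultiplication.MatrixMultiplication.Theorems.FidelityWitnessesFidelityGapTwoSixExplicitLemmaR

/-!
# `FidelityGapTwoSixExplicit` — Lemma A: the missing plane is close to a frame `U ⊗ ĥ`

Part of the proof of `FidelityWitnesses.FidelityGapTwoSixExplicit` (stmt-MatrixMultiplication-14041); see
`FidelityWitnessesFidelityGapTwoSixExplicitDefs.lean` for the line of argument.  Here: `U`-components of
bilinear forms (norms, tracelessness on `annT`, linearity of `rowVec`), the residual along a unit vector,
and LEMMA A: if the rows of the `U`-components of every `ℓ` in a space `L ≤ annT` project onto a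
`≥ 6`-plane `Y ≤ kerSpan` with square norm `≤ δ₂‖ℓ‖²`, `δ₂ ≤ 1/4800`, then for a unit traceless `ĥ`
(the normalised larger component of a unit vector of `L`) one has `‖ℓ‖² − Σ_i |⟪ĥ, hComp i ℓ⟫|² ≤ ‖ℓ‖²/50`
on `L` — Lemma R applied to `ĥ` and the normalised residual.
-/

noncomputable section

namespace Summit.MatrixMultiplication.MatrixMultiplication.Theorems.GapTwoSixExplicit

-- single-conjunct summit: the `Summit.<S>.<P>` prefix repeats `MatrixMultiplication` by design (D-0017)
set_option linter.dupNamespace false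

open scoped BigOperators ComplexConjugate InnerProductSpace
open Literature.Computability.AlgebraicComplexity Module

/-! ## `U`-components of bilinear forms -/

/-- `‖ℓ‖² = Σ_i ‖hComp i ℓ‖²`. [folklore] -/
theorem norm_sq_eq_sum_hComp (ℓ : V16) : ‖ℓ‖ ^ 2 = ∑ i : Fin 2, ‖hComp i ℓ‖ ^ 2 := by
  rw [EuclideanSpace.norm_sq_eq, Fintype.sum_prod_type, Fintype.sum_prod_type]
  refine Finset.sum_congr rfl fun i _ => ?_
  rw [EuclideanSpace.norm_sq_eq, Fintype.sum_prod_type]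
  rfl

/-- `‖hComp i ℓ‖ ≤ ‖ℓ‖`. [folklore] -/
theorem norm_hComp_le (i : Fin 2) (ℓ : V16) : ‖hComp i ℓ‖ ≤ ‖ℓ‖ := by
  have h : ‖hComp i ℓ‖ ^ 2 ≤ ‖ℓ‖ ^ 2 := by
    rw [norm_sq_eq_sum_hComp ℓ, Fin.sum_univ_two]
    fin_cases i <;> simp
  exact le_of_pow_le_pow_left₀ two_ne_zero (norm_nonneg _) h

/-- The `U`-components of an annihilator of the slices of `T` are traceless. [folklore] -/
theorem hComp_mem_traceless {ℓ : V16} (hℓ : ℓ ∈ annT) (i : Fin 2) : hComp i ℓ ∈ traceless := by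
  intro w
  have h := hℓ (i, w)
  simp only [T2_apply, Fintype.sum_prod_type, Fin.sum_univ_two, mul_ite, mul_one, mul_zero] at h
  fin_cases i <;> fin_cases w <;>
    · simp at h
      simpa [hComp] using h

/-- `hComp` is additive. [folklore] -/
theorem hComp_add (i : Fin 2) (ℓ ℓ' : V16) : hComp i (ℓ + ℓ') = hComp i ℓ + hComp i ℓ' := rfl

/-- `hComp` is homogeneous. [folklore] -/
theorem hComp_smul (i : Fin 2) (c : ℂ) (ℓ : V16) : hComp i (c • ℓ) = c • hComp i ℓ := rfl

/-- `rowVec` is homogeneous. [folklore] -/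
theorem rowVec_smul (c : ℂ) (b : V8) (v : Fin 2) : rowVec (c • b) v = c • rowVec b v := by
  apply PiLp.ext; intro q
  simp only [rowVec, PiLp.toLp_apply, PiLp.smul_apply, smul_eq_mul]
  split_ifs <;> simp

/-- `rowVec` is subtractive. [folklore] -/
theorem rowVec_sub (b b' : V8) (v : Fin 2) : rowVec (b - b') v = rowVec b v - rowVec b' v := by
  apply PiLp.ext; intro q
  simp only [rowVec, PiLp.toLp_apply, PiLp.sub_apply]
  split_ifs <;> simp

/-- Pythagoras for the residual of `b` along a unit vector `ĥ`:
`‖b − ⟪ĥ, b⟫ • ĥ‖² = ‖b‖² − |⟪ĥ, b⟫|²`, and the residual is orthogonal to `ĥ`. [folklore] -/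
theorem residual_facts {E : Type*} [NormedAddCommGroup E] [InnerProductSpace ℂ E] {h : E}
    (h1 : ‖h‖ = 1) (b : E) :
    ⟪h, b - ⟪h, b⟫_ℂ • h⟫_ℂ = 0 ∧ ‖b - ⟪h, b⟫_ℂ • h‖ ^ 2 = ‖b‖ ^ 2 - ‖⟪h, b⟫_ℂ‖ ^ 2 := by
  have hh : ⟪h, h⟫_ℂ = 1 := by
    have h1' : ((‖h‖ : ℝ) : ℂ) ^ 2 = 1 := by rw [h1]; norm_num
    rw [inner_self_eq_norm_sq_to_K]; exact h1'
  have horth : ⟪h, b - ⟪h, b⟫_ℂ • h⟫_ℂ = 0 := by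
    rw [inner_sub_right, inner_smul_right, hh, mul_one, sub_self]
  refine ⟨horth, ?_⟩
  -- `b = (b - α h) + α h`, orthogonal summands
  have horth' : ⟪b - ⟪h, b⟫_ℂ • h, ⟪h, b⟫_ℂ • h⟫_ℂ = 0 := by
    rw [inner_smul_right, inner_eq_zero_symm.1 horth, mul_zero]
  have hpy := norm_add_sq_eq_norm_sq_add_norm_sq_of_inner_eq_zero _ _ horth'
  rw [sub_add_cancel, ← pow_two, ← pow_two, ← pow_two, norm_smul, mul_pow, h1] at hpy
  linarith

/-! ## Lemma A: the missing plane is close to `U ⊗ ĥ` -/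

/-- **Lemma A (one-sided structure theorem).**  Let `Y ≤ kerSpan` have dimension `≥ 6`, and let
`L ≠ 0` be a space of annihilators of the slices of `T` all of whose `U`-component rows project
onto `Y` with square norm `≤ δ₂‖ℓ‖²`, `δ₂ ≤ 1/4800`.  Then there is a unit traceless `ĥ` with
`‖ℓ‖² − Σ_i |⟪ĥ, hComp i ℓ⟫|² ≤ ‖ℓ‖²/50` for all `ℓ ∈ L` — i.e. `L` is within `1/√50` of
`U ⊗ ĥ`.  (Exact version, `δ₂ = 0`: the only `10`-planes of `K` passing the `(210)` test are
`U ⊗ ĥ^⊥`.)  Proof: Lemma R applied to `ĥ` and the normalised residual of `hComp i ℓ`. [folklore] -/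
theorem exists_unit_near_of_rows {Y : Submodule ℂ V64} (hY : Y ≤ kerSpan) (hY6 : 6 ≤ finrank ℂ Y)
    {L : Submodule ℂ V16} (hL : L ≤ annT) (hL0 : L ≠ ⊥) {δ2 : ℝ} (hδ0 : 0 ≤ δ2)
    (hδ : δ2 ≤ 1 / 4800)
    (hrow : ∀ ℓ ∈ L, ∀ i v : Fin 2, ‖Y.starProjection (rowVec (hComp i ℓ) v)‖ ^ 2 ≤ δ2 * ‖ℓ‖ ^ 2) :
    ∃ ĥ : V8, ĥ ∈ traceless ∧ ‖ĥ‖ = 1 ∧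
      ∀ ℓ ∈ L, ‖ℓ‖ ^ 2 - ∑ i : Fin 2, ‖⟪ĥ, hComp i ℓ⟫_ℂ‖ ^ 2 ≤ 1 / 50 * ‖ℓ‖ ^ 2 := by
  -- a unit vector of `L` and its larger `U`-component
  obtain ⟨ℓ₁, hℓ₁L, hℓ₁0⟩ := (Submodule.ne_bot_iff L).1 hL0
  set ℓ₀ : V16 := (‖ℓ₁‖⁻¹ : ℂ) • ℓ₁ with hℓ₀def
  have hℓ₀L : ℓ₀ ∈ L := L.smul_mem _ hℓ₁L
  have hℓ₀1 : ‖ℓ₀‖ = 1 := by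
    rw [hℓ₀def, norm_smul, norm_inv, Complex.norm_real, norm_norm, inv_mul_cancel₀ (norm_ne_zero_iff.2 hℓ₁0)]
  obtain ⟨i₀, hi₀⟩ : ∃ i₀ : Fin 2, 1 / 2 ≤ ‖hComp i₀ ℓ₀‖ ^ 2 := by
    by_contra hcon
    push Not at hcon
    have h := norm_sq_eq_sum_hComp ℓ₀
    rw [hℓ₀1, Fin.sum_univ_two] at h
    linarith [hcon 0, hcon 1]
  set bs : V8 := hComp i₀ ℓ₀ with hbsdef
  have hbs0 : bs ≠ 0 := by
    intro h; rw [h, norm_zero] at hi₀; norm_num at hi₀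
  have hbspos : 0 < ‖bs‖ := norm_pos_iff.2 hbs0
  set ĥ : V8 := (‖bs‖⁻¹ : ℂ) • bs with hĥdef
  have hĥ1 : ‖ĥ‖ = 1 := by
    rw [hĥdef, norm_smul, norm_inv, Complex.norm_real, norm_norm, inv_mul_cancel₀ hbspos.ne']
  have hĥt : ĥ ∈ traceless := traceless.smul_mem _ (hComp_mem_traceless (hL hℓ₀L) i₀)
  -- rows of `ĥ`
  have hĥrow : ∀ v, ‖Y.starProjection (rowVec ĥ v)‖ ^ 2 ≤ 2 * δ2 := by
    intro v
    have h := hrow ℓ₀ hℓ₀L i₀ v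
    rw [hℓ₀1, one_pow, mul_one] at h
    rw [hĥdef, rowVec_smul, map_smul, norm_smul, norm_inv, Complex.norm_real, norm_norm, mul_pow,
      inv_pow]
    rw [inv_mul_le_iff₀ (by positivity)]
    calc ‖Y.starProjection (rowVec bs v)‖ ^ 2 ≤ δ2 := h
      _ ≤ ‖bs‖ ^ 2 * (2 * δ2) := by nlinarith
  refine ⟨ĥ, hĥt, hĥ1, fun ℓ hℓ => ?_⟩
  -- the residual of each `U`-component is small
  have hres : ∀ i : Fin 2,
      (399 / 1200 : ℝ) * ‖hComp i ℓ - ⟪ĥ, hComp i ℓ⟫_ℂ • ĥ‖ ^ 2 ≤ 1 / 400 * ‖ℓ‖ ^ 2 := by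
    intro i
    set b : V8 := hComp i ℓ with hbdef
    set α : ℂ := ⟪ĥ, b⟫_ℂ with hαdef
    set r : V8 := b - α • ĥ with hrdef
    obtain ⟨horth, hpy⟩ := residual_facts hĥ1 b
    have hbt : b ∈ traceless := hComp_mem_traceless (hL hℓ) i
    have hbℓ : ‖b‖ ≤ ‖ℓ‖ := norm_hComp_le i ℓ
    have hα : ‖α‖ ≤ ‖ℓ‖ := by
      calc ‖α‖ ≤ ‖ĥ‖ * ‖b‖ := norm_inner_le_norm _ _
        _ ≤ ‖ℓ‖ := by rw [hĥ1, one_mul]; exact hbℓ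
    by_cases hr0 : r = 0
    · have : ‖r‖ = 0 := by rw [hr0, norm_zero]
      rw [this]
      nlinarith [sq_nonneg ‖ℓ‖]
    · -- normalised residual `k`, orthonormal with `ĥ`
      have hrpos : 0 < ‖r‖ := norm_pos_iff.2 hr0
      set k : V8 := (‖r‖⁻¹ : ℂ) • r with hkdef
      have hk1 : ‖k‖ = 1 := by
        rw [hkdef, norm_smul, norm_inv, Complex.norm_real, norm_norm, inv_mul_cancel₀ hrpos.ne']
      have hkt : k ∈ traceless :=
        traceless.smul_mem _ (traceless.sub_mem hbt (traceless.smul_mem _ hĥt))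
      have hĥk : ⟪ĥ, k⟫_ℂ = 0 := by rw [hkdef, inner_smul_right, horth, mul_zero]
      -- rows of `k`
      have hkrow : ∀ v, ‖r‖ ^ 2 * ‖Y.starProjection (rowVec k v)‖ ^ 2 ≤ 6 * δ2 * ‖ℓ‖ ^ 2 := by
        intro v
        have e1 : rowVec k v = (‖r‖⁻¹ : ℂ) • (rowVec b v - α • rowVec ĥ v) := by
          rw [hkdef, rowVec_smul, hrdef, rowVec_sub, rowVec_smul]
        rw [e1, map_smul, norm_smul, norm_inv, Complex.norm_real, norm_norm, mul_pow, inv_pow,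
          ← mul_assoc, mul_inv_cancel₀ (by positivity), one_mul, map_sub, map_smul]
        have h1 := hrow ℓ hℓ i v
        have h2 := hĥrow v
        have h3 : ‖Y.starProjection (rowVec b v) - α • Y.starProjection (rowVec ĥ v)‖
            ≤ ‖Y.starProjection (rowVec b v)‖ + ‖α‖ * ‖Y.starProjection (rowVec ĥ v)‖ := by
          calc _ ≤ ‖Y.starProjection (rowVec b v)‖ + ‖α • Y.starProjection (rowVec ĥ v)‖ :=
                norm_sub_le _ _
            _ = _ := by rw [norm_smul]
        have h4 : ‖Y.starProjection (rowVec b v) - α • Y.starProjection (rowVec ĥ v)‖ ^ 2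
            ≤ 2 * ‖Y.starProjection (rowVec b v)‖ ^ 2
              + 2 * (‖α‖ ^ 2 * ‖Y.starProjection (rowVec ĥ v)‖ ^ 2) := by
          have h3' := pow_le_pow_left₀ (norm_nonneg _) h3 2
          nlinarith [h3', sq_nonneg (‖Y.starProjection (rowVec b v)‖
            - ‖α‖ * ‖Y.starProjection (rowVec ĥ v)‖)]
        have h5 : ‖α‖ ^ 2 ≤ ‖ℓ‖ ^ 2 := pow_le_pow_left₀ (norm_nonneg _) hα 2
        have h6 : ‖α‖ ^ 2 * ‖Y.starProjection (rowVec ĥ v)‖ ^ 2 ≤ ‖ℓ‖ ^ 2 * (2 * δ2) :=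
          mul_le_mul h5 h2 (sq_nonneg _) (sq_nonneg _)
        linarith
      -- Lemma R
      have hR := third_le_sum_norm_sq_starProjection_rowVec hY hY6 hĥt hkt hĥ1 hk1 hĥk
      have hsum : ‖r‖ ^ 2 * (1 / 3) ≤ ‖r‖ ^ 2 * (4 * δ2) + 12 * δ2 * ‖ℓ‖ ^ 2 := by
        have hb0 := mul_le_mul_of_nonneg_left (hĥrow 0) (sq_nonneg ‖r‖)
        have hb1 := mul_le_mul_of_nonneg_left (hĥrow 1) (sq_nonneg ‖r‖)
        have hk0 := hkrow 0
        have hk1 := hkrow 1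
        have hR' := mul_le_mul_of_nonneg_left hR (sq_nonneg ‖r‖)
        rw [Fin.sum_univ_two] at hR'
        have e : ‖r‖ ^ 2 * (‖Y.starProjection (rowVec ĥ 0)‖ ^ 2 + ‖Y.starProjection (rowVec k 0)‖ ^ 2
            + (‖Y.starProjection (rowVec ĥ 1)‖ ^ 2 + ‖Y.starProjection (rowVec k 1)‖ ^ 2))
            = ‖r‖ ^ 2 * ‖Y.starProjection (rowVec ĥ 0)‖ ^ 2 + ‖r‖ ^ 2 * ‖Y.starProjection (rowVec k 0)‖ ^ 2
              + ‖r‖ ^ 2 * ‖Y.starProjection (rowVec ĥ 1)‖ ^ 2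
              + ‖r‖ ^ 2 * ‖Y.starProjection (rowVec k 1)‖ ^ 2 := by ring
        linarith
      -- conclude with `δ2 ≤ 1/4800`
      have h7 := mul_le_mul_of_nonneg_left hδ (sq_nonneg ‖r‖)
      have h8 := mul_le_mul_of_nonneg_right hδ (sq_nonneg ‖ℓ‖)
      linarith
  -- sum the two residuals
  have hdecomp : ‖ℓ‖ ^ 2 - ∑ i : Fin 2, ‖⟪ĥ, hComp i ℓ⟫_ℂ‖ ^ 2
      = ∑ i : Fin 2, ‖hComp i ℓ - ⟪ĥ, hComp i ℓ⟫_ℂ • ĥ‖ ^ 2 := by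
    rw [norm_sq_eq_sum_hComp ℓ, ← Finset.sum_sub_distrib]
    refine Finset.sum_congr rfl fun i _ => ?_
    rw [(residual_facts hĥ1 (hComp i ℓ)).2]
  rw [hdecomp, Fin.sum_univ_two]
  nlinarith [hres 0, hres 1, sq_nonneg ‖ℓ‖]

end Summit.MatrixMultiplication.MatrixMultiplication.Theorems.GapTwoSixExplicit

end
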